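import Literature.IUT.HodgeArakelov.FlTorsorStructureConj
import HarnessLib

/-!
# [IUTchII] Def 2.3 (v) — RIGIDITY of the successor interface `FlTorsorStructureConj`: «hence determines a natural OUTER
# isomorphism `Π_⊇/Π_⊆ ≅ 𝔽_l^{⋊±}`» holds EXACTLY up to the `𝔽^±_l`-torsor ambiguity of the chart — and the typed chart is pinned
# only up to `x ↦ c·x + d`, `c ∈ 𝔽_l^×`

S. Mochizuki, *Inter-universal Teichmüller theory II*, kurims manuscript (Dec. 2020), §2 Def 2.3 (iii) p. 68 («`LabCusp^±(Π_v)` … admits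
a natural action by `𝔽_l^×`, as well as a zero element `η^0_v` and a `±`-canonical element `η^±_v` well-defined up to multiplication by
`±1`»), Def 2.3 (v) p. 69 («the images … in `LabCusp^±(Π_⊆)` of the various structures on `LabCusp^±(Π_v)` reviewed in (iii) determine
[in the terminology of [IUTchI], Definition 6.1, (i)] a natural `𝔽^±_l`-torsor structure on `LabCusp^±(Π_⊆)`. Moreover, the natural action of
`Π_⊇/Π_⊆` on `Π_⊆` preserves this `𝔽^±_l`-torsor structure, hence determines a natural outer isomorphism `Π_⊇/Π_⊆ ≅ 𝔽_l^{⋊±}`»); *IUT I*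
Def 6.1 (i) p. 155 («an `𝔽^±_l`-torsor … a set `T` with an `𝔽_l^{⋊±}`-orbit of bijections `T ≃ 𝔽_l`») [claim: Mochizuki2012, status:
disputed] (IUTchII §2 Def 2.3 (v), kurims p.69) (D-0012 claim key; record-only; nothing printed is asserted here).

abc-iut cell, seat abc-iut-w5-d243 gen 4; NV/faithfulness row «FlTorsorStructureConj-RIGIDITY» (sequel of p436492 / p438863).  PROOF-ONLY,
INTERFACE LEVEL over every `(S, T, W, C)`.  For two successor structures `F F' : FlTorsorStructureConj C` (p436492; same `conjAct` by
`conjAct_eq`):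

1. `exists_chart_affine` — their charts `LabCusp^±(Π̂^±_v) ≃ 𝔽_l` differ by an AFFINE map `x ↦ c·x + d` with `c ∈ 𝔽_l^×` (an element of
   `Π̂^cor_v` acting as the `l`-cycle `x ↦ x + 1` in one chart acts as `x ↦ ±x + a'` in the other; `−` would make it an involution),
   and then (`quotIso_right_eq`, `quotIso_left_eq`) `quotIso' ḡ = (c·a + d − ε·d, ε)` where `quotIso ḡ = (a, ε)`;
2. `exists_quotIso_eq_conj` — if the charts lie in ONE `𝔽_l^{⋊±}`-orbit (`c = ±1`, print's «`𝔽^±_l`-torsor structure»), the two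
   isomorphisms `Π̂^cor_v/Π̂^±_v ≃* 𝔽_l^{⋊±}` are CONJUGATE by `(d, ±1) ∈ 𝔽_l^{⋊±}` — the kernel form of «determines a natural OUTER
   isomorphism»;
3. `exists_rescaled` — conversely every successor structure has, for every `c ∈ 𝔽_l^×`, a RESCALED twin (chart `c·chart`, same
   conjugation action, `quotIso` composed with `(a, ε) ↦ (c·a, ε)`), and (`exists_quotIso_not_conj`, `l ≠ 3`) for `c = 2` the twin's
   `quotIso` is NOT conjugate to the original: an inner automorphism of `𝔽_l^{⋊±}` rescales translations only by `±1`.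

READING (a typing observation, not a claim about print): the successor interface (chart + conjugation action) pins the chart up to
`AGL₁(𝔽_l) = 𝔽_l ⋊ 𝔽_l^×`, hence the outer isomorphism class only up to the outer automorphisms `(a, ε) ↦ (c·a, ε)` of `𝔽_l^{⋊±}`;
print pins it further through the IMAGES of Def 2.3 (iii)'s `η^0_v ↦ 0`, `η^±_v ↦ ±1` in `LabCusp^±(Π̂^±_v)` — a map
`LabCusp^±(Π_v) → LabCusp^±(Π̂^±_v)` the typed interface does not carry (GAP-LEDGER candidate G-w5d243-2, interface owner's v-next).
By item 2, ANY law placing the chart in a fixed `𝔽_l^{⋊±}`-orbit makes the outer isomorphism well defined.  No `def`, no instance, no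
named fact; typed ≠ proved; no side taken on [IUTchIII] Cor. 3.12; nothing here asserts abc proved or refuted.
-/

noncomputable section

namespace Literature.IUT.HodgeArakelov

universe u

namespace FlTorsorStructureConj

open Literature.IUT.HodgeTheaters

variable {S : BadPlaceSetting.{u}} {P : TopGroup.{u}} {T : TemperedCoverings S P} {W : PlusMinusTower T}
  {C : CuspidalInertiaData W}

/-! ## 0. Arithmetic of `𝔽_l` for the setting's odd prime `l` -/

/-- `2 ≠ 0` in `𝔽_l` (`l` odd). [claim: Mochizuki2012, status: disputed] (IUTchII §2 Def 2.3 (v), kurims p.69) -/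
theorem two_ne_zero_fl : (2 : ZMod S.l) ≠ 0 := by
  intro h
  apply FlTorsorStructure.neg_one_ne_one (S := S)
  linear_combination -h

/-- A sign `±1` is determined by its image in `𝔽_l`. [claim: Mochizuki2012, status: disputed] (IUTchII §2 Def 2.3 (v), kurims p.69) -/
theorem units_eq_of_cast_eq {ε ε' : ℤˣ} (h : ((ε : ℤ) : ZMod S.l) = ((ε' : ℤ) : ZMod S.l)) : ε = ε' := by
  rcases Int.units_eq_one_or ε with rfl | rfl <;> rcases Int.units_eq_one_or ε' with rfl | rfl
  · rfl
  · exfalso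
    rw [Units.val_one, Units.val_neg, Units.val_one, Int.cast_one, Int.cast_neg, Int.cast_one] at h
    exact FlTorsorStructure.neg_one_ne_one (S := S) h.symm
  · exfalso
    rw [Units.val_one, Units.val_neg, Units.val_one, Int.cast_one, Int.cast_neg, Int.cast_one] at h
    exact FlTorsorStructure.neg_one_ne_one (S := S) h
  · rfl

/-- An element of `Π̂^cor_v` acting (through `F`'s chart) as the translation `x ↦ x + 1`.
[claim: Mochizuki2012, status: disputed] (IUTchII §2 Def 2.3 (v), kurims p.69) -/
theorem exists_translate_one (F : FlTorsorStructureConj C) :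
    ∃ g : W.Corhat, ∀ t, F.chart (F.conjAct g t) = F.chart t + 1 := by
  obtain ⟨g, hg⟩ := QuotientGroup.mk_surjective (F.quotIso.symm (FlPM.mk 1 1))
  refine ⟨g, fun t => ?_⟩
  rw [F.conjAct_chart, hg, MulEquiv.apply_symm_apply, FlPM.mk_left, FlPM.mk_right, toAdd_ofAdd, Units.val_one, Int.cast_one,
    one_mul, add_comm]

/-! ## 1. Two successor structures: charts differ by an affine map `x ↦ c·x + d`, `c ∈ 𝔽_l^×` -/

/-- **Charts of two successor structures differ by an AFFINE bijection of `𝔽_l`**: `F'.chart t = c · F.chart t + d` with `c ≠ 0`.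
(Both charts intertwine the SAME conjugation action; an element acting as `x ↦ x + 1` for `F` acts as `x ↦ ±x + a'` for `F'`, the sign
`−` being excluded since `x ↦ x + 1` is not an involution; then induct.) [claim: Mochizuki2012, status: disputed] (IUTchII §2 Def 2.3 (v), kurims p.69) -/
theorem exists_chart_affine (F F' : FlTorsorStructureConj C) :
    ∃ c d : ZMod S.l, c ≠ 0 ∧ ∀ t, F'.chart t = c * F.chart t + d := by
  haveI : Fact S.l.Prime := ⟨S.l_prime⟩
  have hact : F'.conjAct = F.conjAct := conjAct_eq F' F
  obtain ⟨g, hg⟩ := exists_translate_one F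
  -- `σ := F'.chart ∘ F.chart⁻¹` satisfies `σ (x + 1) = ε' σ x + a'`
  set a' : ZMod S.l := Multiplicative.toAdd (F'.quotIso (QuotientGroup.mk g)).left with ha'
  set ε' : ℤˣ := (F'.quotIso (QuotientGroup.mk g)).right with hε'
  have hσ : ∀ x : ZMod S.l, F'.chart (F.chart.symm (x + 1)) = a' + ((ε' : ℤ) : ZMod S.l) * F'.chart (F.chart.symm x) := by
    intro x
    have h1 : F.chart.symm (x + 1) = F.conjAct g (F.chart.symm x) := by
      apply F.chart.injective
      rw [Equiv.apply_symm_apply, hg, Equiv.apply_symm_apply]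
    rw [h1, ← hact, F'.conjAct_chart]
  -- the sign is `+1`: otherwise `σ (x + 2) = σ x`
  have hε'1 : ε' = 1 := by
    rcases Int.units_eq_one_or ε' with h | h
    · exact h
    · exfalso
      have h2 : ∀ x : ZMod S.l, F'.chart (F.chart.symm (x + 1 + 1)) = F'.chart (F.chart.symm x) := by
        intro x
        rw [hσ, hσ, h, Units.val_neg, Units.val_one, Int.cast_neg, Int.cast_one]
        ring
      have h3 := F.chart.symm.injective (F'.chart.injective (h2 0))
      apply two_ne_zero_fl (S := S)
      linear_combination h3
  rw [hε'1, Units.val_one, Int.cast_one] at hσ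
  simp only [one_mul] at hσ
  -- induct: `σ n = σ 0 + a' n`
  have hn : ∀ n : ℕ, F'.chart (F.chart.symm n) = F'.chart (F.chart.symm 0) + a' * n := by
    intro n
    induction n with
    | zero => simp
    | succ n ih => rw [Nat.cast_succ, hσ, ih]; ring
  have hall : ∀ x : ZMod S.l, F'.chart (F.chart.symm x) = F'.chart (F.chart.symm 0) + a' * x := by
    intro x
    have h := hn x.val
    rwa [ZMod.natCast_zmod_val] at h
  refine ⟨a', F'.chart (F.chart.symm 0), ?_, fun t => ?_⟩
  · intro h0
    have h := hall 1
    rw [h0, zero_mul, add_zero] at h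
    have h' := F.chart.symm.injective (F'.chart.injective h)
    exact one_ne_zero h'
  · have h := hall (F.chart t)
    rw [Equiv.symm_apply_apply] at h
    rw [h]; ring

/-- With `F'.chart = c · F.chart + d`: the SIGNS of the two outer isomorphisms agree, `(quotIso' ḡ).right = (quotIso ḡ).right`.
[claim: Mochizuki2012, status: disputed] (IUTchII §2 Def 2.3 (v), kurims p.69) -/
theorem quotIso_right_eq (F F' : FlTorsorStructureConj C) {c d : ZMod S.l} (hc : c ≠ 0)
    (h : ∀ t, F'.chart t = c * F.chart t + d) (q : W.Corhat ⧸ W.pmHat) : (F'.quotIso q).right = (F.quotIso q).right := by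
  haveI : Fact S.l.Prime := ⟨S.l_prime⟩
  obtain ⟨g, rfl⟩ := QuotientGroup.mk_surjective q
  have hact : F'.conjAct = F.conjAct := conjAct_eq F' F
  have key : ∀ x : ZMod S.l,
      c * (Multiplicative.toAdd (F.quotIso (QuotientGroup.mk g)).left + ((F.quotIso (QuotientGroup.mk g)).right : ℤ) * x) + d =
        Multiplicative.toAdd (F'.quotIso (QuotientGroup.mk g)).left +
          ((F'.quotIso (QuotientGroup.mk g)).right : ℤ) * (c * x + d) := by
    intro x
    have e1 := F.conjAct_chart g (F.chart.symm x)
    have e2 := F'.conjAct_chart g (F.chart.symm x)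
    rw [Equiv.apply_symm_apply] at e1
    rw [hact, h, h, Equiv.apply_symm_apply, e1] at e2
    exact e2
  have k0 := key 0
  have k1 := key 1
  apply units_eq_of_cast_eq (S := S)
  have hcε : c * ((((F.quotIso (QuotientGroup.mk g)).right : ℤ) : ZMod S.l) - ((F'.quotIso (QuotientGroup.mk g)).right : ℤ)) = 0 := by
    linear_combination k1 - k0
  rcases mul_eq_zero.mp hcε with h0 | h0
  · exact absurd h0 hc
  · exact (sub_eq_zero.mp h0).symm

/-- With `F'.chart = c · F.chart + d`: the TRANSLATION parts satisfy `a' = c·a + d − ε·d`.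
[claim: Mochizuki2012, status: disputed] (IUTchII §2 Def 2.3 (v), kurims p.69) -/
theorem quotIso_left_eq (F F' : FlTorsorStructureConj C) {c d : ZMod S.l} (hc : c ≠ 0)
    (h : ∀ t, F'.chart t = c * F.chart t + d) (q : W.Corhat ⧸ W.pmHat) :
    Multiplicative.toAdd (F'.quotIso q).left =
      c * Multiplicative.toAdd (F.quotIso q).left + d - ((F.quotIso q).right : ℤ) * d := by
  have hr := quotIso_right_eq F F' hc h q
  obtain ⟨g, rfl⟩ := QuotientGroup.mk_surjective q
  have hact : F'.conjAct = F.conjAct := conjAct_eq F' F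
  have e1 := F.conjAct_chart g (F.chart.symm 0)
  have e2 := F'.conjAct_chart g (F.chart.symm 0)
  rw [Equiv.apply_symm_apply] at e1
  rw [hact, h, h, Equiv.apply_symm_apply, e1, hr] at e2
  linear_combination -e2

/-! ## 2. Same `𝔽_l^{⋊±}`-orbit of charts ⇒ CONJUGATE outer isomorphisms -/

/-- **«hence determines a natural OUTER isomorphism»** (kernel form): if the charts of two successor structures lie in the same
`𝔽_l^{⋊±}`-orbit — `F'.chart = ε₀ · F.chart + d`, `ε₀ = ±1` (print's `𝔽^±_l`-torsor structure, [IUTchI] Def 6.1 (i)) — then their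
isomorphisms `Π̂^cor_v/Π̂^±_v ≃* 𝔽_l^{⋊±}` are CONJUGATE by `h = (d, ε₀) ∈ 𝔽_l^{⋊±}`: the OUTER isomorphism is the same.
[claim: Mochizuki2012, status: disputed] (IUTchII §2 Def 2.3 (v), kurims p.69) -/
theorem exists_quotIso_eq_conj (F F' : FlTorsorStructureConj C) (ε₀ : ℤˣ) (d : ZMod S.l)
    (h : ∀ t, F'.chart t = ((ε₀ : ℤ) : ZMod S.l) * F.chart t + d) :
    ∃ h : FlPM S.l, ∀ q, F'.quotIso q = h * F.quotIso q * h⁻¹ := by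
  haveI : Fact S.l.Prime := ⟨S.l_prime⟩
  have hl2 : 2 < S.l := lt_of_le_of_ne S.l_prime.two_le (Ne.symm S.l_odd)
  have hc : (((ε₀ : ℤ) : ZMod S.l)) ≠ 0 := by
    rcases Int.units_eq_one_or ε₀ with rfl | rfl
    · rw [Units.val_one, Int.cast_one]; exact one_ne_zero
    · rw [Units.val_neg, Units.val_one, Int.cast_neg, Int.cast_one, neg_ne_zero]; exact one_ne_zero
  refine ⟨FlPM.mk d ε₀, fun q => ?_⟩
  have hr := quotIso_right_eq F F' hc h q
  have hl := quotIso_left_eq F F' hc h q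
  -- compare the two sides through the faithful action of `𝔽_l^{⋊±}` on `𝔽_l`
  apply FlPM.toPerm_injective hl2
  ext z
  rw [FlPM.toPerm_apply, FlPM.toPerm_apply, mul_smul, mul_smul]
  -- `F'.quotIso q • z = ε z + a'`, `h • (F.quotIso q • (h⁻¹ • z))`
  set x := F.quotIso q with hx
  set y := F'.quotIso q with hy
  have hz : (FlPM.mk d ε₀)⁻¹ • z = ε₀ • (z - d) := by
    have e : FlPM.mk d ε₀ • (ε₀ • (z - d)) = z := by
      rw [FlPM.mk_smul, smul_smul, Int.units_mul_self, one_smul, sub_add_cancel]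
    calc (FlPM.mk d ε₀)⁻¹ • z = (FlPM.mk d ε₀)⁻¹ • (FlPM.mk d ε₀ • (ε₀ • (z - d))) := by rw [e]
      _ = ε₀ • (z - d) := inv_smul_smul _ _
  rw [hz, FlPM.smul_def y, FlPM.smul_def x, FlPM.mk_smul, hr, hl]
  obtain ⟨a, ε⟩ := x
  simp only [Units.smul_def, zsmul_eq_mul, smul_sub]
  rcases Int.units_eq_one_or ε₀ with rfl | rfl <;> rcases Int.units_eq_one_or ε with rfl | rfl <;>
    simp only [Units.val_one, Units.val_neg, Int.cast_one, Int.cast_neg] <;> ring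

/-- In particular two successor structures with charts in one `𝔽_l^{⋊±}`-orbit induce the SAME isomorphism up to `Inn(𝔽_l^{⋊±})`:
for every `g ∈ Π̂^cor_v` the two images of `ḡ` are conjugate. [claim: Mochizuki2012, status: disputed] (IUTchII §2 Def 2.3 (v), kurims p.69) -/
theorem isConj_quotIso_of_chart_sign (F F' : FlTorsorStructureConj C) (ε₀ : ℤˣ) (d : ZMod S.l)
    (h : ∀ t, F'.chart t = ((ε₀ : ℤ) : ZMod S.l) * F.chart t + d) (q : W.Corhat ⧸ W.pmHat) :
    IsConj (F.quotIso q) (F'.quotIso q) := by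
  obtain ⟨k, hk⟩ := exists_quotIso_eq_conj F F' ε₀ d h
  exact isConj_iff.mpr ⟨k, by rw [hk q]⟩

/-! ## 3. Rescaling: the typed chart is pinned only up to `𝔽_l^×` -/

/-- **Rescaled twin**: for every successor structure `F` and every `c ∈ 𝔽_l^×` there is a successor structure with chart `c · F.chart`,
the SAME conjugation action, and `quotIso` rescaled on translation parts: `(c·a, ε)` where `F.quotIso ḡ = (a, ε)`.
[claim: Mochizuki2012, status: disputed] (IUTchII §2 Def 2.3 (v), kurims p.69) -/
theorem exists_rescaled (F : FlTorsorStructureConj C) (c : (ZMod S.l)ˣ) :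
    ∃ F' : FlTorsorStructureConj C, (∀ t, F'.chart t = c * F.chart t) ∧ F'.conjAct = F.conjAct ∧
      ∀ q, (F'.quotIso q).right = (F.quotIso q).right ∧
        Multiplicative.toAdd (F'.quotIso q).left = c * Multiplicative.toAdd (F.quotIso q).left := by
  -- the rescaling automorphism `(a, ε) ↦ (c·a, ε)` of `𝔽_l^{⋊±}`
  let ψf : FlPM S.l → FlPM S.l := fun x => ⟨Multiplicative.ofAdd ((c : ZMod S.l) * Multiplicative.toAdd x.left), x.right⟩
  let ψg : FlPM S.l → FlPM S.l := fun x => ⟨Multiplicative.ofAdd ((c⁻¹ : (ZMod S.l)ˣ) * Multiplicative.toAdd x.left), x.right⟩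
  have hmul : ∀ x y, ψf (x * y) = ψf x * ψf y := by
    intro x y
    refine SemidirectProduct.ext ?_ ?_
    · change Multiplicative.ofAdd ((c : ZMod S.l) * Multiplicative.toAdd (x * y).left) =
        Multiplicative.ofAdd ((c : ZMod S.l) * Multiplicative.toAdd x.left) *
          signAct S.l x.right (Multiplicative.ofAdd ((c : ZMod S.l) * Multiplicative.toAdd y.left))
      simp only [SemidirectProduct.mul_left, signAct_apply, toAdd_ofAdd, toAdd_mul, Units.smul_def, zsmul_eq_mul]
      rw [← ofAdd_add]
      congr 1; ring
    · rfl
  let ψ : FlPM S.l ≃* FlPM S.l :=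
    { toFun := ψf
      invFun := ψg
      left_inv := fun x => by
        refine SemidirectProduct.ext ?_ rfl
        change Multiplicative.ofAdd (((c⁻¹ : (ZMod S.l)ˣ) : ZMod S.l) *
          Multiplicative.toAdd (Multiplicative.ofAdd ((c : ZMod S.l) * Multiplicative.toAdd x.left))) = x.left
        rw [toAdd_ofAdd, ← mul_assoc, Units.inv_mul, one_mul, ofAdd_toAdd]
      right_inv := fun x => by
        refine SemidirectProduct.ext ?_ rfl
        change Multiplicative.ofAdd ((c : ZMod S.l) *
          Multiplicative.toAdd (Multiplicative.ofAdd (((c⁻¹ : (ZMod S.l)ˣ) : ZMod S.l) * Multiplicative.toAdd x.left))) = x.left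
        rw [toAdd_ofAdd, ← mul_assoc, Units.mul_inv, one_mul, ofAdd_toAdd]
      map_mul' := hmul }
  have hψ : ∀ x, ψ x = ψf x := fun _ => rfl
  refine ⟨{ chart := F.chart.trans c.mulLeft
            quotIso := F.quotIso.trans ψ
            conjAct := F.conjAct
            conjAct_chart := fun g t => ?_
            conj_stable := F.conj_stable
            conjAct_spec := F.conjAct_spec }, fun t => rfl, rfl, fun q => ⟨rfl, ?_⟩⟩
  · change (c : ZMod S.l) * F.chart (F.conjAct g t) =
      Multiplicative.toAdd (ψ (F.quotIso (QuotientGroup.mk g))).left +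
        ((ψ (F.quotIso (QuotientGroup.mk g))).right : ℤ) * ((c : ZMod S.l) * F.chart t)
    rw [F.conjAct_chart, hψ]
    change _ = Multiplicative.toAdd (Multiplicative.ofAdd ((c : ZMod S.l) * _)) + _
    rw [toAdd_ofAdd]
    ring
  · change Multiplicative.toAdd (ψ (F.quotIso q)).left = _
    rw [hψ]
    exact toAdd_ofAdd _

/-- Inner automorphisms of `𝔽_l^{⋊±}` rescale the translation `x ↦ x + 1` only by `±1`: `h (1, +) h⁻¹ = (±1, +)`.
[claim: Mochizuki2012, status: disputed] (IUTchII §2 Def 2.3 (v), kurims p.69) -/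
theorem conj_transl_one (h : FlPM S.l) :
    h * FlPM.mk 1 1 * h⁻¹ = FlPM.mk ((h.right : ℤ) : ZMod S.l) 1 := by
  have hl2 : 2 < S.l := lt_of_le_of_ne S.l_prime.two_le (Ne.symm S.l_odd)
  apply FlPM.toPerm_injective hl2
  ext z
  rw [FlPM.toPerm_apply, FlPM.toPerm_apply, mul_smul, mul_smul, FlPM.mk_smul, one_smul, FlPM.smul_inv_smul_add,
    FlPM.mk_smul, one_smul, Units.smul_def, zsmul_eq_mul, mul_one]

/-- **The successor interface does NOT determine the outer isomorphism** (`l ≠ 3`): every successor structure `F` has a twin `F'`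
(the `c = 2` rescaling) whose `quotIso` is NOT conjugate to `F`'s — some `ḡ` has non-conjugate images.  What is missing is the tie of
the chart to the images of Def 2.3 (iii)'s `η^0_v`, `η^±_v` (GAP-LEDGER candidate G-w5d243-2); cf. `exists_quotIso_eq_conj`.
[claim: Mochizuki2012, status: disputed] (IUTchII §2 Def 2.3 (v), kurims p.69) -/
theorem exists_quotIso_not_conj (F : FlTorsorStructureConj C) (hl3 : S.l ≠ 3) :
    ∃ F' : FlTorsorStructureConj C, F'.conjAct = F.conjAct ∧ ¬ ∃ h : FlPM S.l, ∀ q, F'.quotIso q = h * F.quotIso q * h⁻¹ := by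
  haveI : Fact S.l.Prime := ⟨S.l_prime⟩
  obtain ⟨F', -, hact, hq⟩ := exists_rescaled F (Units.mk0 (2 : ZMod S.l) two_ne_zero_fl)
  refine ⟨F', hact, ?_⟩
  rintro ⟨h, hh⟩
  -- a class `ḡ` with `F.quotIso ḡ = (1, +)`; then `F'.quotIso ḡ = (2, +)` must be `h (1, +) h⁻¹ = (±1, +)`
  obtain ⟨q, hq1⟩ := F.quotIso.symm.surjective.exists.mpr ⟨FlPM.mk 1 1, rfl⟩
  have hq1' : F.quotIso q = FlPM.mk 1 1 := by rw [← hq1, MulEquiv.apply_symm_apply]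
  have e := hh q
  rw [hq1', conj_transl_one] at e
  have e2 := (hq q).2
  rw [e, hq1', FlPM.mk_left, FlPM.mk_left, toAdd_ofAdd, toAdd_ofAdd, Units.val_mk0, mul_one] at e2
  -- `±1 = 2` in `𝔽_l`
  rcases Int.units_eq_one_or h.right with h1 | h1 <;> rw [h1] at e2
  · rw [Units.val_one, Int.cast_one] at e2
    apply one_ne_zero (α := ZMod S.l)
    linear_combination -e2
  · rw [Units.val_neg, Units.val_one, Int.cast_neg, Int.cast_one] at e2
    have h3 : ((3 : ℕ) : ZMod S.l) = 0 := by
      rw [Nat.cast_ofNat]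
      linear_combination -e2
    rw [ZMod.natCast_eq_zero_iff] at h3
    exact hl3 ((Nat.prime_dvd_prime_iff_eq S.l_prime Nat.prime_three).mp h3)

end FlTorsorStructureConj

end Literature.IUT.HodgeArakelov

end
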